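import Literature.NumberTheory.Automorphic.StrongArtinGL2GaloisSideProofs
import HarnessLib

/-!
# Langlands–Tunnell over `ℚ` from a weight-one dictionary valid away from finitely many primes
(pure proofs; companion to `StrongArtinGL2GaloisSideProofs`)

A *proofs* file: theorems only. `StrongArtinGL2GaloisSideProofs` assembles **lang.S30**
(`langlands_tunnell ρ`) from Gelbart's Thm. 2.1, the weight-one dictionary Prop. 4.2
(`exists_isNewform1_of_isPiOfArtinRep`: the newform `f` of `π(σ)` with the Satake parameters of `π`
at **every** `p ∤ N`, `N` the level of `f`) and Deligne–Serre's Thm. 4.1, through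
`isGaloisRepOfNewform1_of_isPiOfArtinRep_of_satake`. That step compares `σ` with Deligne–Serre's `ρ_f`
at *almost all* primes only (strong multiplicity one on the Galois side), so it — and with it
lang.S30 — needs the dictionary only **away from finitely many primes**:

* `isGaloisRepOfNewform1_of_isPiOfArtinRep_of_satake_cofinite` — if `π = π(σ)` a.e., `π` has the
  Satake parameters of the newform `f ∈ S₁(Γ₁(N))` at every `p ∤ M` for *some* `M`, and `ρ` is
  attached to `f` away from `N`, then `σ` is attached to `f` away from `N`;
* `langlands_tunnell_of_strongArtin_of_deligneSerre_cofinite` — **lang.S30 for every `ρ`** from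
  strong Artin for solvable `σ`, Deligne–Serre, and the *cofinite* weight-one dictionary
  "an odd irreducible `π(σ)` corresponds to a weight-one newform `f` with the Satake parameters of `π`
  matching the Hecke polynomials of `f` at all `p ∤ M`, some `M`" — the form of the dictionary
  produced bottom-up in the tree (`StrongArtinGL2WeightOneDescent`: descent of a weight-one new
  vector, level-lowering by the eigenvalue-packet theorem, whence the auxiliary `M`).

The literal Prop. 4.2 (`exists_isNewform1_of_isPiOfArtinRep`: matching at every `p ∤ N` and
`N = cond σ`) contains in addition the unramifiedness of `π` at the primes `p ∣ M`, `p ∤ N`, i.e.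
local–global compatibility there (Gelbart's Prop. 4.1, or newform theory with multiplicity one);
that is not needed for lang.S30 along this file.

## References

* S. Gelbart, *Three lectures …* (1997), Thm. 2.1, §2.6, §4.1 (p. 177), Prop. 4.2 [Gelbart1997].
* P. Deligne, J.-P. Serre, *Formes modulaires de poids 1*, Ann. Sci. ÉNS 7 (1974), Thm. 4.1
  [DeligneSerreASENS1974].
-/

noncomputable section

open scoped MatrixGroups NumberField Polynomial Classical ModularForm
open NumberField IsDedekindDomain Field Polynomial Filter
open CongruenceSubgroup

namespace Literature.NumberTheory.Automorphic

open EllipticCurves.ModularForms Rat.HeightOneSpectrum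

variable {hcpt : isCompact_glFiniteIntegralLevel 2 ℚ} {σ : GaloisRepresentations.FramedArtinRep ℚ 2}
  {π : CuspidalAutomorphicRepData 2 ℚ hcpt} {N : ℕ} [NeZero N] {f : CuspForm (Gamma1 N) 1}

/-- **`σ` is attached to the newform of `π(σ)`, from matching away from finitely many primes**:
if `π = π(σ)` a.e., `π` has the Satake parameters of the newform `f ∈ S₁(Γ₁(N))` at every
`p ∤ M` (any `M ≥ 1`), and some `ρ` is attached to `f` away from `N` (Deligne–Serre), then `σ` is
attached to `f` away from `N` (the proof of `isGaloisRepOfNewform1_of_isPiOfArtinRep_of_satake`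
compares `σ` and `ρ` at almost all `p` only). [cite: Gelbart1997, §2.6 and §4.1 (p. 177)]
[cite: DeligneSerreASENS1974, Thm. 4.1] -/
theorem isGaloisRepOfNewform1_of_isPiOfArtinRep_of_satake_cofinite (hπ : IsPiOfArtinRep σ π.1)
    {M : ℕ} [NeZero M]
    (hsat : ∀ v : HeightOneSpectrum (𝓞 ℚ), ¬ ((primesEquiv v : Nat.Primes) : ℕ) ∣ M →
      ∃ α : Multiset ℂ, π.1.HasSatakeParamAt v α ∧
        satakePolynomial α =
          (EllipticCurves.ModularForms.heckePolynomial f (primesEquiv v : Nat.Primes)).map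
            (algebraMap (coeffCharField f) ℂ))
    {ρ : GaloisRepresentations.FramedArtinRep ℚ 2}
    (hρ : IsGaloisRepOfNewform1 f (algebraMap (coeffCharField f) ℂ) {p | p ∣ N} ρ) :
    IsGaloisRepOfNewform1 f (algebraMap (coeffCharField f) ℂ) {p | p ∣ N} σ := by
  -- a.e. `σ` and `ρ` share the Frobenius polynomial `X² - a_p X + ε(p)`
  have hgoodM : ∀ᶠ v : HeightOneSpectrum (𝓞 ℚ) in cofinite,
      ¬ ((primesEquiv v : Nat.Primes) : ℕ) ∣ M := by
    rw [Filter.eventually_cofinite]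
    simpa only [not_not] using finite_setOf_primesEquiv_dvd M
  have hgoodN : ∀ᶠ v : HeightOneSpectrum (𝓞 ℚ) in cofinite,
      ¬ ((primesEquiv v : Nat.Primes) : ℕ) ∣ N := by
    rw [Filter.eventually_cofinite]
    simpa only [not_not] using finite_setOf_primesEquiv_dvd N
  have hae : ∀ᶠ v in cofinite, ∃ P : ℂ[X], σ.HasFrobCharpolyAt v P ∧ ρ.HasFrobCharpolyAt v P := by
    refine ((hπ.and hgoodM).and hgoodN).mono ?_
    rintro v ⟨⟨⟨α, hα, -, hP⟩, hvM⟩, hvN⟩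
    obtain ⟨α', hα', hpoly⟩ := hsat v hvM
    have e : α = α' := AutomorphicRepData.hasSatakeParamAt_unique_holds π.1 hα hα'
    subst e
    exact ⟨_, hP, hpoly ▸ (hρ v hvN).2⟩
  have hch :=
    GaloisRepresentations.FramedArtinRep.charpoly_eq_of_eventually_hasFrobCharpolyAt σ ρ hae
  intro v hv
  exact ⟨GaloisRepresentations.FramedArtinRep.isUnramifiedAt_of_charpoly_eq hch (hρ v hv).1,
    GaloisRepresentations.FramedArtinRep.hasFrobCharpolyAt_of_charpoly_eq hch (hρ v hv).2⟩

/-- **lang.S30 from strong Artin, Deligne–Serre and the *cofinite* weight-one dictionary.**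
If every odd irreducible `π = π(σ)` corresponds to a weight-one newform `f` of some level `N` whose
Hecke polynomials match the Satake parameters of `π` at all `p ∤ M` for some `M`, then (with
Gelbart's Thm. 2.1 and Deligne–Serre's Thm. 4.1) `langlands_tunnell ρ` holds for every `ρ`.
Compare `langlands_tunnell_of_strongArtin_of_deligneSerre` (dictionary at every `p ∤ N`).
[cite: Gelbart1997, Thm. 2.1, §2.6 and Prop. 4.2] [cite: DeligneSerreASENS1974, Thm. 4.1] -/
theorem langlands_tunnell_of_strongArtin_of_deligneSerre_cofinite (hSA : strongArtin_of_isSolvable)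
    (hW : ∀ (hcpt : isCompact_glFiniteIntegralLevel 2 ℚ)
      (σ : GaloisRepresentations.FramedArtinRep ℚ 2) (π : CuspidalAutomorphicRepData 2 ℚ hcpt),
      σ.toGaloisRep.IsIrreducible → σ.IsOdd → IsPiOfArtinRep σ π.1 →
        ∃ (N : ℕ) (_ : NeZero N) (f : CuspForm (Gamma1 N) 1), IsNewform1 f ∧ ∃ (M : ℕ) (_ : NeZero M),
          ∀ v : HeightOneSpectrum (𝓞 ℚ), ¬ ((primesEquiv v : Nat.Primes) : ℕ) ∣ M →
            ∃ α : Multiset ℂ, π.1.HasSatakeParamAt v α ∧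
              satakePolynomial α =
                (EllipticCurves.ModularForms.heckePolynomial f (primesEquiv v : Nat.Primes)).map
                  (algebraMap (coeffCharField f) ℂ))
    (hDS : ∀ {N : ℕ} [NeZero N], exists_complexGaloisRep_of_weight_one (N := N))
    (ρ : GaloisRepresentations.FramedArtinRep ℚ 2) : langlands_tunnell ρ := by
  intro hirr hodd hsolv
  have hproj : IsSolvable (GaloisRepresentations.projectiveImage ρ.toMonoidHom) :=
    (GaloisRepresentations.isSolvable_projectiveImage_iff _).mpr hsolv
  obtain ⟨hcpt, π, hπ⟩ := hSA ρ hirr hproj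
  obtain ⟨N, hN, f, hf, M, hM, hsat⟩ := hW hcpt ρ π hirr hodd hπ
  obtain ⟨ρf, hρf, -, -, -⟩ := hDS hf
  exact ⟨N, hN, f, hf, isGaloisRepOfNewform1_of_isPiOfArtinRep_of_satake_cofinite hπ hsat hρf⟩

end Literature.NumberTheory.Automorphic

end
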